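import Summits.QuantumFields.YangMills.Theorems.BalabanUVNodesN12AtRecord12WitnessLine
import Summits.QuantumFields.YangMills.Theorems.BalabanUVNodesN12AtRecord12TermPin

/-!
# BalabanUVNodes ∕ N12 AT THE TERM-PINNED (1.89) LAYER ON A LIVE RE-PIN — `λᵀ := (λ.pinRPrime θ₉).pinD189T θ₉ σ s N₀ p₁` (dag-n12-e's modules 11 ∕ `…TermPin`) composed with
# this seat's witness-line discharges: on a run in the coupling window N12's (1.89) DISPLAY is n12-e's theorem from (1.80) + the four ℍ-leaves + print's p. 200 conditions + geometry +
# the β-box bound, `hfib` is free at the live re-pin, and the guard ∕ N13's 𝐑-row of the `stub_nodes12` body are theorems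
# (sequel of `BalabanUVNodesN12AtRecord12WitnessLine` and of n12-e's `BalabanUVNodesN12AtRecord12TermPin`; Track A, DAG node N12 = [B15, Balaban1989LargeFieldI] CMP 122 (1989) 175;
# cluster K1′ `StabilityBAtRecordR12e` = stmt-QuantumFields-19903 (rev 15); seat `pub-ymgap-dag-n12-d` g5 (R134 s2, HANDOFF trigger t8), 2026-08-27; count-neutral, NOT a discharge)

HONEST FRAMING.  Count-neutral kernel BOOKKEEPING BY NAME; nothing of Bałaban's asserted — (1.80), the ℍ-leaves (1.90)–(1.97), Proposition 1, the positive mass of the live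
pre-𝐑 terms, the provisos at the re-pin and [I] (1.22)'s β-box bound stay DISPLAYED; N12 NOT discharged.

WHY THIS FILE.  dag-n12-e's module 11 `B15Claim189PrintedConditions` (p482355) pins the (1.89) situation's top level `k := kSel P + 1` and regions `Ω_j` := the (2.1)-chain of ONE
TERM `s P` of the (2.18) index (`ResidW.pinD189T`) and proves `h189_pinD189T_of_h180` (the (1.89) display FROM the (1.80) display + the four ℍ-leaves + located geometry + residual
numerics + PRINT'S TWO p. 200 CONDITIONS + levels + the run's window + the β-box bound); its Summits sequel `…N12AtRecord12TermPin` (dag-n12-e g4, landed while this file was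
drafted — its §1 `pinAllT_eq` ∕ `pinAllT_levels` ∕ `b15Leaf_WOfRecord₁₀_pinAllT_of_deg_massSel` and §2 are IMPORTED, not restated) knits that into this seat's STAGE-9-generic leaf
(with `hfib`, `hdeg`) and into module 1's body (guard `hU` and 𝐑-row `hR` displayed).  THIS file adds what the LIVE RE-PIN gives on top (modules 2–3 of this seat): `hfib` free and
`hmassSel` in live-mass form (`…LiveSelector` §3), the guard conjunct and N13's 𝐑-row THEOREMS (`…WitnessLine` §1).  Since the window is NOT an antecedent of `Dag.B15_main`
(seat g3's located note) and — n12-e's census — [III] (2.7)'s `SmallnessFor γ …` is unsatisfiable at `γ ≥ 1∕2` (so the window form does not instantiate on K0a's `θ₀ˡⁱᵛᵉ`,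
`γ = 1∕2`; n12-e's window-free `_of_flow` forms will), the body below keeps the (1.89) slot as a per-run DISJUNCTION «raw (1.89) display ∨ (window ∧ ℍ-leaves)», and §3 offers
the assembly-free form in which the closer hands the N12 row `h12 : ∀ P, B15Leaf (W₀ P)` run by run.
WHAT THIS FILE PROVES (theorems only).
* §1 `new189_pinAllT_one_zero₁₂` — at admissible Stage-12 parameters the (1.80) ∕ (1.89) antecedent at `λᵀ` HOLDS at `(1, 0)` on every run in the window up to `n ≥ kSel P + 1`
  (module 1's census at `σᵀ P := ((σ P).pinTerm (s P)).pinNumerics θ.τ9 N₀`; `h ≤ k` automatic).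
* §2 `b15Leaf_WOfRecord₁₀_pinAllT_liveRepin_of_massLive_of_h180` — THE [IV] LEAF AT THE LIVE RE-PIN's BUNDLE OF RECORD `WOfRecord₁₀ θ₉ λᵀ P` FOR A RUN IN THE WINDOW with
  `kSel P < K`: from `Provisos₁₀` at the re-pin, positive mass of the LIVE terms, Prop. 1, (1.80), the ℍ-leaves, geometry, numerics, print's conditions, levels, window, flow
  numerics, β-box — NO (1.89) display, NO `hfib`, NO `hdeg` (module 2 §3 ∘ n12-e; window form); `b15Leaf_res_W_pinW_liveRepin_pinAllT_of_massLive_of_h180` (pointed-row form).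
* §3 `nodes₁₂_pointed_liveRepin_pinW_of_leaf` ∕ `nodesAtSomeRecord₁₂_of_pointed_liveRepin_pinW_of_leaf` — at a live re-pin W-pinned at ANY `W₀`, module 1's pointed interface ∕
  stub body with the guard and N13's 𝐑-row DISCHARGED and the N12 row `h12 : ∀ P, B15Leaf (W₀ P)` handed as such (closers produce it run by run from §2 ∕ n12-e's §1).
* §4 `h189_pinAllT_of_disj`, `nodes₁₂_pointed_liveRepin_pinW_pinAllT`, `nodesAtSomeRecord₁₂_of_pointed_liveRepin_pinW_pinAllT` — module 3 §2 at `σᵀ` with the (1.89) slot of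
  `hN12` replaced by «`Claim189 … ∨ (window ∧ ℍ-leaves)`» per run and the run-independent residue as section hypotheses.
WHAT N12 THEN COSTS per run in the window (typing strength, NOT a second gap): `Provisos₁₂` at the re-pin (K0′), `hdeg` (runs with `K ≤ kSel P`), positive mass of the live
pre-𝐑 terms (NODE 00), Prop. 1 at `λ.LF P` (dag-n12-c), (1.80) at `U₀ = U_{k,Z}(V_Λ)` of record and the four ℍ-leaves ([B11]-at-objects, N07's content), the β-box bound
([I] (1.22), the flow nodes), the closer's residual situation data (`Z″, Z, Λ`, cubes, `β, L₀, δ, B₃, B₅, O(1)`, `dist`) with print's two conditions, a window whose `γ` is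
(2.7)-small, and ONE TERM `s P` per run (the W carrier's granularity — n12-e module 4 located note (i), NODE 00).  One finite four-torus programme at fixed `ε`; nothing
continuum ∕ ℝ⁴ ∕ OS ∕ mass gap ∕ Clay.  0 `sorry`, 0 `def`, standard axioms.  Filed `--supports` K1′ (19903) `--as helper`.
Sources: [Balaban1989LargeFieldI] (0.2)–(0.6) pp.176–177, Prop. 1 p.194, (1.80) p.195, (1.82) p.196, (1.88)–(1.89) p.198, pp.199–200, (1.90)–(1.97); [Balaban1988Convergent]
(2.1) p.254, (2.7)–(2.8) pp.255–256, (2.18) p.257, (3.16)–(3.25) pp.268–270; [Balaban1989LargeFieldII] Thm 1 + (0.1) pp.355–356, p.391; [Balaban1987RG1] (1.22) p.264.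
-/

noncomputable section

open MeasureTheory
open scoped Matrix.Norms.L2Operator

namespace Summit.QuantumFields.YangMills.BalabanUVNodes.N12AtRecord12TermPinned
open Literature.MathematicalPhysics.QuantumFieldTheory.Balaban1983to89
open Literature.MathematicalPhysics.QuantumFieldTheory.Balaban1983to89.T4Continuum (T4Family)
open Literature.MathematicalPhysics.QuantumFieldTheory.Balaban1983to89.DagBinding (WorldP leavesP PrintedCarriersR PrintedCarriers15 B15Leaf B8LeafR B9LeafX B11Leaf Nodes)
open Literature.MathematicalPhysics.QuantumFieldTheory.Balaban1983to89.Node00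
open FlowStep (BetaUpperH)
open B14FlowStep (SmallnessFor)
open B15Claim189Assembly (Setting189 new189 chiPP dom half)
open B15 (Prop1Printed Ineq180)
open B15.BasicStep (Claim189)
open B15.PrelimIntegrations (Ineq191 Ineq195)
open B15Chi124DetSets (E124)
open B15DeterminingSets (MSField)
open B14DomainGeom (Pt)
open B8Eq17ClassAkV1 (plaqsOf)
open GaugeGroup (dist1)
open GaugeField (plaqHol)
open B15Claim189NumericsPin (pinNumerics_h_le_k)
open B15Claim189PrintedConditions (omegaOfChain h189_pinD189T_of_h180)
open Summit.QuantumFields.YangMills.BalabanUVNodes.N12AtRecord12Pointed (new189_pinAllχ₀_one_zero₁₂ nodes₁₂_pointed_pinW nodesAtSomeRecord₁₂_of_pointed_pinW)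
open Summit.QuantumFields.YangMills.BalabanUVNodes.N12AtRecord12LiveSelector (b15Leaf_WOfRecord₁₀_pinAllχ₀_liveRepin_of_massLive)
open Summit.QuantumFields.YangMills.BalabanUVNodes.N12AtRecord12WitnessLine (rRow_liveRepin guard_liveRepin_of_ztUnity
  nodes₁₂_pointed_liveRepin_pinW_of_massSel_of_signs nodesAtSomeRecord₁₂_of_pointed_liveRepin_pinW_of_massSel_of_signs)

variable {N : ℕ} [NeZero N] {F : T4Family}

/-! ## §1 Non-vacuity: at admissible Stage-12 parameters the (1.80) ∕ (1.89) antecedent at `λᵀ` holds at `(1, 0)` on every run in the window -/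

section NonVacuity
variable (θ : Stage12Params F N) (lam : ResidW F N) (σ : ∀ P : B12.RunParams, Sit189 F N P.K)
  (s : ∀ P : B12.RunParams, SeqOfRecord F θ.ν θ.τ9.M (gOfRecord₁₀ F N θ.toStage9Params P) P.K (lam.kSel P + 1)) (N₀ p₁ : ℕ)

/-- **THE DISPLAYS AT `λᵀ` ARE NEVER VACUOUS ON A RUN IN THE WINDOW UP TO `n ≥ kSel P + 1`** (admissible Stage-12 `θ`): `new189 (λᵀ.D189 P) (1, 0)` — module 1's
`new189_pinAllχ₀_one_zero₁₂` at `σᵀ` (`h ≤ k` is `Nat.sub_le`, the top level is `kSel P + 1`). [cite: Balaban1989LargeFieldI, (1.82) p.196, (1.89) p.198; Balaban1988Convergent, (2.4) p.255, (2.12) p.256 (bookkeeping census)] -/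
theorem new189_pinAllT_one_zero₁₂ (hθ : θ.Admissible F N) (P : B12.RunParams) {n : ℕ}
    (hI : Step.InInterval θ.γ n (gOfRecord₁₀ F N θ.toStage9Params P)) (hkn : lam.kSel P + 1 ≤ n) :
    new189 (((lam.pinRPrime θ.toStage9Params).pinD189T θ.toStage9Params σ s N₀ p₁).D189 P)
      ((1 : MSField (F.P P.K) (SU N)), fun _ _ => (0 : EuclideanSpace ℝ (Fin (N ^ 2 - 1)))) :=
  new189_pinAllχ₀_one_zero₁₂ θ lam (fun P => ((σ P).pinTerm (s P)).pinNumerics θ.τ9 N₀) p₁ hθ P hI (pinNumerics_h_le_k _ _ _) hkn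

end NonVacuity

/-! ## §2 The [IV] leaf at the live re-pin's bundle of record, run in the window: (1.89) discharged, `hfib` free, `hdeg` void -/

section Leaf
variable (Θ : Stage12Params F N) (lam : ResidW F N) (σ : ∀ P : B12.RunParams, Sit189 F N P.K)
  (s : ∀ P : B12.RunParams, SeqOfRecord F Θ.ν Θ.τ9.M (gOfRecord₁₀ F N (Θ.liveRepin F N).toStage9Params P) P.K (lam.kSel P + 1)) (N₀ p₁ : ℕ)

/-- **★ THE [IV] LEAF AT `WOfRecord₁₀ θ₉ λᵀ P` (`θ₉` the live re-pin's Stage-9 tuple) FOR A RUN IN THE WINDOW UP TO `kSel P + 1 ≤ K` — NO (1.89) DISPLAY**: module 2's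
`b15Leaf_WOfRecord₁₀_pinAllχ₀_liveRepin_of_massLive` at `σᵀ` with the `h189` slot SUPPLIED by n12-e's `h189_pinD189T_of_h180`.  Stated with a defining equation `hD` for the
letters (instantiate `rfl`).  DISPLAYED: `Provisos₁₀` at the re-pin, positive mass of the LIVE pre-𝐑 terms at the step, Prop. 1 at `λ.LF P`, (1.80) (`h180`), the four ℍ-leaves
(`L91h L95 L91 L97`), the geometry (`hZk hgeom hbox`), the residual numerics and signs, print's two p. 200 conditions (`hN₀ hMl`), levels, the window `hI`, the flow numerics
(`hA₀ S hβ₀ hε10`) and the β-box bound `hup`. [cite: Balaban1989LargeFieldI, (0.2)–(0.6) p.176, p.176 ll.14–16, Prop. 1 (1.78) p.194, (1.80) p.195, (1.88)–(1.89) p.198, pp.199–200; Balaban1988Convergent, (2.1) p.254, (2.8) p.256; Balaban1987RG1, (1.22) p.264] -/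
theorem b15Leaf_WOfRecord₁₀_pinAllT_liveRepin_of_massLive_of_h180 (hP : (Θ.liveRepin F N).toStage9Params.Provisos₁₀) {P : B12.RunParams} (hK : lam.kSel P < P.K)
    {D : Setting189 (F.P P.K) (SU N) (MSField (F.P P.K) (SU N) × ((j : ℕ) → VecField (F.P P.K) j (EuclideanSpace ℝ (Fin (N ^ 2 - 1))))) (Pt (F.P P.K).d)}
    (hD : D = ((lam.pinRPrime (Θ.liveRepin F N).toStage9Params).pinD189T (Θ.liveRepin F N).toStage9Params σ s N₀ p₁).D189 P)
    (hmassLive : ∀ a, LiveSeq F N Θ.ν Θ.τ9 P (gOfRecord₁₀ F N (Θ.liveRepin F N).toStage9Params P) (lam.kSel P + 1)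
        (slotsTOfRecord F N Θ.ν Θ.τ9 (EOfRecord₁₀ F N (Θ.liveRepin F N).toStage9Params) (wOfRecord₉ F N (Θ.liveRepin F N).toStage9Params)
          (Θ.liveRepin F N).ppSel P (gOfRecord₁₀ F N (Θ.liveRepin F N).toStage9Params P) (lam.kSel P + 1)) a →
      0 < ∫ V, rterm (repTOfRecord9 F N Θ.ν Θ.τ9 (EOfRecord₁₀ F N (Θ.liveRepin F N).toStage9Params) (wOfRecord₉ F N (Θ.liveRepin F N).toStage9Params)
        (Θ.liveRepin F N).ppSel P (gOfRecord₁₀ F N (Θ.liveRepin F N).toStage9Params P) (lam.kSel P)) a V ∂(fieldMeasure (F.P P.K) (lam.kSel P + 1) (SU N)))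
    (hP1 : Prop1Printed (lam.LF P))
    -- levels, residual numerics, print's two conditions (p. 200)
    (hN2 : 2 ≤ N₀) (hNN : N₀ ≤ Θ.τ9.Nmem) (hNk : N₀ ≤ lam.kSel P + 1)
    (hβ0 : 0 ≤ (σ P).β) (hβ : (σ P).β ≤ 1 / 4) (hL₀ : 2 ≤ (σ P).L₀) (hL₀L : (σ P).L₀ ^ 2 ≤ ((F.P P.K).L : ℝ))
    (hB : 0 ≤ (σ P).O1 * (σ P).B₃ * (σ P).B₅) (hδ : 0 ≤ (σ P).δ) (hdist : ∀ p, 0 ≤ (σ P).dist p)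
    (hN₀ : (2 + (121 / 120) ^ 2 * ((σ P).O1 * (σ P).B₃ * (σ P).B₅ * (Θ.τ9.M : ℝ) ^ 5)) * (((σ P).L₀ ^ 2) ^ (N₀ - 1))⁻¹ ≤ 1 / 4)
    (hMl : (121 / 120) ^ 2 * ((σ P).O1 * (σ P).B₃ * (σ P).B₅ * (Θ.τ9.M : ℝ) ^ 5) * Real.exp (-(4 * (σ P).δ * (Θ.τ9.M : ℝ))) ≤ 1 / 12)
    -- flow numerics, the run's window, the β-box bound
    (hA₀ : 0 ≤ Θ.ν.A₀) {β' β₀ : ℝ} {L : ℕ} (S : SmallnessFor Θ.γ β' β₀ L Θ.ν.p₀) (hβ₀ : β₀ ≤ 1 / 2) (hε10 : Θ.γ * p0Profile Θ.ν.A₀ Θ.ν.p₀ Θ.γ ≤ 1 / 10)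
    (hI : Step.InInterval Θ.γ (lam.kSel P + 1) (gOfRecord₁₀ F N (Θ.liveRepin F N).toStage9Params P))
    (hup : BetaUpperH β' Θ.γ (betaOfRecord₁₀ F N (Θ.liveRepin F N).toStage9Params))
    -- located geometry
    (hZk : ∀ m, lam.kSel P + 1 - N₀ < m → m < lam.kSel P + 1 → (σ P).Zpp (lam.kSel P + 1) ∩ omegaOfChain (s P) m ⊆ omegaOfChain (s P) (m + 1))
    (hgeom : ∀ m, D.k₀ < m → m < D.k → ∀ p ∈ plaqsOf (D.Ω m \ D.Ω (m + 1)), 4 * ((m : ℝ) - D.k₀) * D.M ≤ D.dist p)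
    (hbox : ∀ p ∈ plaqsOf (half D), D.boxOf p ∈ D.halfcubes ∧ p ∈ D.plaqT (D.boxOf p))
    -- the four ℍ-leaves and (1.80)
    (L91h : ∀ U, new189 D U → ∀ p ∈ plaqsOf (half D),
      Ineq191 (dist1 (plaqHol (D.Upp U) p)) (D.devV'' U p) D.α ((D.L ^ D.h)⁻¹) (D.ε D.h) (E124 D.ε D.L D.η D.k D.h))
    (L95 : ∀ U, new189 D U → ∀ p ∈ plaqsOf (half D),
      Ineq195 (D.devV'' U p) (dist1 (plaqHol (D.Uhalf U (D.boxOf p)) p)) D.α ((D.L ^ D.h)⁻¹) (D.ε D.h) (E124 D.ε D.L D.η D.k D.h))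
    (L91 : ∀ U, new189 D U → ∀ j, D.h ≤ j → j ≤ D.k → ∀ p ∈ plaqsOf (dom D j),
      Ineq191 (dist1 (plaqHol (D.Upp U) p)) (D.dev97 U p) D.α ((D.L ^ j)⁻¹) (D.ε j) (E124 D.ε D.L D.η D.k j))
    (L97 : ∀ U, new189 D U → ∀ j, D.h ≤ j → j ≤ D.k → ∀ p ∈ plaqsOf (dom D j),
      Ineq191 (D.dev97 U p) (D.dev0 U p) D.α ((D.L ^ j)⁻¹) (D.ε j) (E124 D.ε D.L D.η D.k j))
    (h180 : ∀ U, new189 D U → ∀ i, D.h ≤ i → i ≤ D.k → ∀ q ∈ plaqsOf (dom D i),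
      Ineq180 (D.dev0 U q) (D.ε D.k) D.η D.B₃ D.B₅ D.M D.δ (D.dist q) D.O1) :
    B15Leaf (WOfRecord₁₀ F N (Θ.liveRepin F N).toStage9Params
      ((lam.pinRPrime (Θ.liveRepin F N).toStage9Params).pinD189T (Θ.liveRepin F N).toStage9Params σ s N₀ p₁) P) := by
  subst hD
  exact b15Leaf_WOfRecord₁₀_pinAllχ₀_liveRepin_of_massLive Θ lam (fun P => ((σ P).pinTerm (s P)).pinNumerics Θ.τ9 N₀) p₁ hP hK hmassLive hP1
    (fun U hU i hi hik q hq => h180 U hU i hi hik q hq)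
    (h189_pinD189T_of_h180 (lam := lam.pinRPrime (Θ.liveRepin F N).toStage9Params) (σT := σ) (sT := s) (N₀ := N₀) (p₁ := p₁) P hN2 hNN hNk hβ0 hβ hL₀
      hL₀L hB hδ hdist hN₀ hMl hA₀ S hβ₀ hε10 hI hup hZk hgeom hbox L91h L95 L91 L97 h180)

/-- **N12's POINTED ROW at the live re-pin W-pinned at its bundle of record `pinW (WOfRecord₁₂ θ₉′ λᵀ)`, run in the window — NO (1.89) DISPLAY** (the previous theorem read as
`B15Leaf ((θ₉′.pinW W₀).res.W P)`, module 1 `pinW_res_W`). [cite: Balaban1989LargeFieldI, (0.2)–(0.6) p.176, Prop. 1 (1.78) p.194, (1.80) p.195, (1.89) p.198; Balaban1989LargeFieldII, Thm 1 p.355 (bookkeeping)] -/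
theorem b15Leaf_res_W_pinW_liveRepin_pinAllT_of_massLive_of_h180 (hP : (Θ.liveRepin F N).toStage9Params.Provisos₁₀) {P : B12.RunParams}
    (hK : lam.kSel P < P.K)
    {D : Setting189 (F.P P.K) (SU N) (MSField (F.P P.K) (SU N) × ((j : ℕ) → VecField (F.P P.K) j (EuclideanSpace ℝ (Fin (N ^ 2 - 1))))) (Pt (F.P P.K).d)}
    (hD : D = ((lam.pinRPrime (Θ.liveRepin F N).toStage9Params).pinD189T (Θ.liveRepin F N).toStage9Params σ s N₀ p₁).D189 P)
    (hmassLive : ∀ a, LiveSeq F N Θ.ν Θ.τ9 P (gOfRecord₁₀ F N (Θ.liveRepin F N).toStage9Params P) (lam.kSel P + 1)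
        (slotsTOfRecord F N Θ.ν Θ.τ9 (EOfRecord₁₀ F N (Θ.liveRepin F N).toStage9Params) (wOfRecord₉ F N (Θ.liveRepin F N).toStage9Params)
          (Θ.liveRepin F N).ppSel P (gOfRecord₁₀ F N (Θ.liveRepin F N).toStage9Params P) (lam.kSel P + 1)) a →
      0 < ∫ V, rterm (repTOfRecord9 F N Θ.ν Θ.τ9 (EOfRecord₁₀ F N (Θ.liveRepin F N).toStage9Params) (wOfRecord₉ F N (Θ.liveRepin F N).toStage9Params)
        (Θ.liveRepin F N).ppSel P (gOfRecord₁₀ F N (Θ.liveRepin F N).toStage9Params P) (lam.kSel P)) a V ∂(fieldMeasure (F.P P.K) (lam.kSel P + 1) (SU N)))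
    (hP1 : Prop1Printed (lam.LF P))
    (hN2 : 2 ≤ N₀) (hNN : N₀ ≤ Θ.τ9.Nmem) (hNk : N₀ ≤ lam.kSel P + 1)
    (hβ0 : 0 ≤ (σ P).β) (hβ : (σ P).β ≤ 1 / 4) (hL₀ : 2 ≤ (σ P).L₀) (hL₀L : (σ P).L₀ ^ 2 ≤ ((F.P P.K).L : ℝ))
    (hB : 0 ≤ (σ P).O1 * (σ P).B₃ * (σ P).B₅) (hδ : 0 ≤ (σ P).δ) (hdist : ∀ p, 0 ≤ (σ P).dist p)
    (hN₀ : (2 + (121 / 120) ^ 2 * ((σ P).O1 * (σ P).B₃ * (σ P).B₅ * (Θ.τ9.M : ℝ) ^ 5)) * (((σ P).L₀ ^ 2) ^ (N₀ - 1))⁻¹ ≤ 1 / 4)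
    (hMl : (121 / 120) ^ 2 * ((σ P).O1 * (σ P).B₃ * (σ P).B₅ * (Θ.τ9.M : ℝ) ^ 5) * Real.exp (-(4 * (σ P).δ * (Θ.τ9.M : ℝ))) ≤ 1 / 12)
    (hA₀ : 0 ≤ Θ.ν.A₀) {β' β₀ : ℝ} {L : ℕ} (S : SmallnessFor Θ.γ β' β₀ L Θ.ν.p₀) (hβ₀ : β₀ ≤ 1 / 2) (hε10 : Θ.γ * p0Profile Θ.ν.A₀ Θ.ν.p₀ Θ.γ ≤ 1 / 10)
    (hI : Step.InInterval Θ.γ (lam.kSel P + 1) (gOfRecord₁₀ F N (Θ.liveRepin F N).toStage9Params P))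
    (hup : BetaUpperH β' Θ.γ (betaOfRecord₁₀ F N (Θ.liveRepin F N).toStage9Params))
    (hZk : ∀ m, lam.kSel P + 1 - N₀ < m → m < lam.kSel P + 1 → (σ P).Zpp (lam.kSel P + 1) ∩ omegaOfChain (s P) m ⊆ omegaOfChain (s P) (m + 1))
    (hgeom : ∀ m, D.k₀ < m → m < D.k → ∀ p ∈ plaqsOf (D.Ω m \ D.Ω (m + 1)), 4 * ((m : ℝ) - D.k₀) * D.M ≤ D.dist p)
    (hbox : ∀ p ∈ plaqsOf (half D), D.boxOf p ∈ D.halfcubes ∧ p ∈ D.plaqT (D.boxOf p))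
    (L91h : ∀ U, new189 D U → ∀ p ∈ plaqsOf (half D),
      Ineq191 (dist1 (plaqHol (D.Upp U) p)) (D.devV'' U p) D.α ((D.L ^ D.h)⁻¹) (D.ε D.h) (E124 D.ε D.L D.η D.k D.h))
    (L95 : ∀ U, new189 D U → ∀ p ∈ plaqsOf (half D),
      Ineq195 (D.devV'' U p) (dist1 (plaqHol (D.Uhalf U (D.boxOf p)) p)) D.α ((D.L ^ D.h)⁻¹) (D.ε D.h) (E124 D.ε D.L D.η D.k D.h))
    (L91 : ∀ U, new189 D U → ∀ j, D.h ≤ j → j ≤ D.k → ∀ p ∈ plaqsOf (dom D j),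
      Ineq191 (dist1 (plaqHol (D.Upp U) p)) (D.dev97 U p) D.α ((D.L ^ j)⁻¹) (D.ε j) (E124 D.ε D.L D.η D.k j))
    (L97 : ∀ U, new189 D U → ∀ j, D.h ≤ j → j ≤ D.k → ∀ p ∈ plaqsOf (dom D j),
      Ineq191 (D.dev97 U p) (D.dev0 U p) D.α ((D.L ^ j)⁻¹) (D.ε j) (E124 D.ε D.L D.η D.k j))
    (h180 : ∀ U, new189 D U → ∀ i, D.h ≤ i → i ≤ D.k → ∀ q ∈ plaqsOf (dom D i),
      Ineq180 (D.dev0 U q) (D.ε D.k) D.η D.B₃ D.B₅ D.M D.δ (D.dist q) D.O1) :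
    B15Leaf (((Θ.liveRepin F N).pinW F N (WOfRecord₁₂ F N (Θ.liveRepin F N)
      ((lam.pinRPrime (Θ.liveRepin F N).toStage9Params).pinD189T (Θ.liveRepin F N).toStage9Params σ s N₀ p₁))).res.W P) :=
  b15Leaf_WOfRecord₁₀_pinAllT_liveRepin_of_massLive_of_h180 Θ lam σ s N₀ p₁ hP hK hD hmassLive hP1 hN2 hNN hNk hβ0 hβ hL₀ hL₀L hB hδ hdist hN₀ hMl hA₀ S hβ₀ hε10
    hI hup hZk hgeom hbox L91h L95 L91 L97 h180

end Leaf

/-! ## §3 At a live re-pin with ANY W-component `W₀`: the pointed interface and the stub body with the guard and N13's 𝐑-row discharged (the closer supplies `h12` run by run) -/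

section AnyW
variable (Θ : Stage12Params F N) (hP : (Θ.liveRepin F N).Provisos₁₂ F N) (W₀ : B12.RunParams → PrintedCarriers15)

/-- **★ THE THIRTEEN NODES AT A WORLD BOUND TO THE LIVE RE-PIN W-PINNED AT ANY `W₀`, N13's 𝐑-ROW A THEOREM** — module 1's `nodes₁₂_pointed_pinW` at `θ := Θ.liveRepin` with `hR` :=
module 3's `rRow_liveRepin`; the N12 row is `h12 : ∀ P, B15Leaf (W₀ P)` AS SUCH (produce it run by run: n12-e's `…TermPin.b15Leaf_WOfRecord₁₀_pinAllT_of_deg_massSel` ∕ §2 above at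
`W₀ := WOfRecord₁₂ θ₉′ λᵀ`, or module 1 §2's junk `W₀` for the census).  DISPLAYED: `Provisos₁₂` at the re-pin, `Θ.Admissible`, the signs, rows N05–N11 + Cor.-3, `h12`.
COMPOSITE; NOT a discharge; count-neutral. [cite: Balaban1989LargeFieldII, Thm 1 p.355, (0.1) pp.355–356, p.391; Balaban1989LargeFieldI, (0.2)–(0.6) p.176, p.177, Prop. 1 p.194; Balaban1988Convergent, p.244, Thm 2 p.263 (node bookkeeping at the re-pin's objects)] -/
theorem nodes₁₂_pointed_liveRepin_pinW_of_leaf (hθ : Θ.Admissible F N) (hκ : 0 ≤ Θ.s2.lf.κ) (hE₀ : 0 ≤ Θ.s2.lf.E₀) (hB₀ : 0 ≤ Θ.s2.lf.B₀)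
    (w : WorldP) (hC : w.C = (datumOfRecord₁₂ F N (Θ.liveRepin F N) hP).C) (hγ : 0 < w.γ ∧ w.γ ≤ Θ.γ) (hL : w.L = (Θ.L : ℝ))
    (hup : ∀ P, w.up P = upOfRecord₅C F N (((Θ.liveRepin F N).pinW F N W₀).toStage5₁₂ F N) P)
    (h05 : ∀ P : B12.RunParams,
      B8LeafR (Θ.res.X P).d8 (Θ.res.X P).L8 (Θ.res.X P).C₂ (Θ.res.X P).B₁' (Θ.res.X P).B₀' (Θ.res.X P).B₁ (Θ.res.X P).B₂ (Θ.res.X P).c₁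
        (Θ.res.X P).inp8 (Θ.res.X P).B₀β (Θ.res.X P).loc8 (Θ.res.X P).fam8R (Θ.res.X P).lan8 (Θ.res.X P).cub8 (Θ.res.X P).toAxial8)
    (h06 : ∀ P : B12.RunParams, B9LeafX (Θ.res.Y P))
    (h07 : ∀ P : B12.RunParams, B11Leaf (Θ.res.Z P))
    (h08 : ∀ P : B12.RunParams, ∃ (Xc : PrintedCarriersR) (I : Type) (C : B10Assembly.Consts) (T : I → B10.TowerRun),
      Nonempty (∀ i, B10Assembly.LeafSystem C (T i)) ∧ Θ.res.X P = Xc.withTowerRuns10 T)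
    (h09 : ∀ P : B12.RunParams, B12Sec2to5.Lemma4Printed (Θ.res.X P).F12 (Θ.res.X P).c12)
    (h09T : ∀ P : B12.RunParams, (leavesP w P).smallCouplings → (leavesP w P).smallFieldInductive)
    (h10 : ∀ P : B12.RunParams, B9LeafX (Θ.res.Y P) →
      (B10.Thm1PrintedCompact (Θ.res.X P).runs10 ∧ B10.Thm2Printed (Θ.res.X P).runs10) →
        B11Leaf (Θ.res.Z P) → B12Sec2to5.Lemma4Printed (Θ.res.X P).F12 (Θ.res.X P).c12 →
          B13.Lemma1Printed (Θ.res.X P).S13 (Θ.res.X P).c13 ∧ B13.Lemma2Printed (Θ.res.X P).S13 (Θ.res.X P).c13 ∧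
            B13.Lemma3Printed (Θ.res.X P).S13 (Θ.res.X P).c13)
    (h11 : ∀ P : B12.RunParams, (leavesP w P).b7 → (leavesP w P).b8 → (leavesP w P).b9 → (leavesP w P).b10 → (leavesP w P).b11 →
      (leavesP w P).smallCouplings → (leavesP w P).smallFieldInductive → (leavesP w P).flowControl →
        ∀ k, k < P.K → SLaw₁₂ F N (Θ.liveRepin F N) P k → TLaw₁₂ F N (Θ.liveRepin F N) P k)
    (h12 : ∀ P : B12.RunParams, B15Leaf (W₀ P))
    (hcor3 : ∃ R : B14Cor3.ReprFamily (datumOfRecord₁₂ F N (Θ.liveRepin F N) hP).C,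
      B14Cor3.LeafH (datumOfRecord₁₂ F N (Θ.liveRepin F N) hP).C R w.γ ∧ B14Cor3.LeafU1 (datumOfRecord₁₂ F N (Θ.liveRepin F N) hP).C R w.γ ∧
        B14Cor3.LeafU2 (datumOfRecord₁₂ F N (Θ.liveRepin F N) hP).C R w.γ w.ep ∧ B14Cor3.LeafL1 (datumOfRecord₁₂ F N (Θ.liveRepin F N) hP).C R w.γ ∧
          B14Cor3.LeafL2 (datumOfRecord₁₂ F N (Θ.liveRepin F N) hP).C R w.γ w.em) :
    IsRecordOfRecord₁₂C F N (datumOfRecord₁₂ F N (Θ.liveRepin F N) hP) w ∧ ∀ P : B12.RunParams, Nodes (leavesP w P) :=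
  nodes₁₂_pointed_pinW (Θ.liveRepin F N) hP hθ.liveRepin W₀ w hC hγ hL hup h05 h06 h07 h08 h09 h09T h10 h11 h12 (rRow_liveRepin Θ hP hθ hκ hE₀ hB₀) hcor3

/-- **★ THE BODY OF `NodesAtSomeRecord12` AT A LIVE RE-PIN W-PINNED AT ANY `W₀` — GUARD AND 𝐑-ROW GONE**: module 1's `nodesAtSomeRecord₁₂_of_pointed_pinW` at `θ := Θ.liveRepin` with
`hU := ⟨Θ.ZtUnity, K0a's slotsNondegenerate_liveRepin hP.base⟩` and `hR := rRow_liveRepin`.  DISPLAYED: `Provisos₁₂` at the re-pin, `Θ.Admissible`, `Θ.ZtUnity`, the signs, rows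
N05–N11 + Cor.-3, `h12 : ∀ P, B15Leaf (W₀ P)`.  COMPOSITE; NOT a discharge; count-neutral. [cite: Balaban1989LargeFieldII, Thm 1 p.355 + p.391; Balaban1988Convergent, p.244, Thm 2 p.263, (3.16)–(3.22) pp.268–269, (3.24) p.270; Balaban1989LargeFieldI, (0.3)–(0.4) p.176 (bookkeeping: the stub's body on a live re-pin)] -/
theorem nodesAtSomeRecord₁₂_of_pointed_liveRepin_pinW_of_leaf (hθ : Θ.Admissible F N) (hzt : Θ.ZtUnity F N) (hκ : 0 ≤ Θ.s2.lf.κ) (hE₀ : 0 ≤ Θ.s2.lf.E₀)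
    (hB₀ : 0 ≤ Θ.s2.lf.B₀)
    (w : WorldP) (hC : w.C = (datumOfRecord₁₂ F N (Θ.liveRepin F N) hP).C) (hγ : 0 < w.γ ∧ w.γ ≤ Θ.γ) (hL : w.L = (Θ.L : ℝ))
    (hup : ∀ P, w.up P = upOfRecord₅C F N (((Θ.liveRepin F N).pinW F N W₀).toStage5₁₂ F N) P)
    (h05 : ∀ P : B12.RunParams,
      B8LeafR (Θ.res.X P).d8 (Θ.res.X P).L8 (Θ.res.X P).C₂ (Θ.res.X P).B₁' (Θ.res.X P).B₀' (Θ.res.X P).B₁ (Θ.res.X P).B₂ (Θ.res.X P).c₁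
        (Θ.res.X P).inp8 (Θ.res.X P).B₀β (Θ.res.X P).loc8 (Θ.res.X P).fam8R (Θ.res.X P).lan8 (Θ.res.X P).cub8 (Θ.res.X P).toAxial8)
    (h06 : ∀ P : B12.RunParams, B9LeafX (Θ.res.Y P))
    (h07 : ∀ P : B12.RunParams, B11Leaf (Θ.res.Z P))
    (h08 : ∀ P : B12.RunParams, ∃ (Xc : PrintedCarriersR) (I : Type) (C : B10Assembly.Consts) (T : I → B10.TowerRun),
      Nonempty (∀ i, B10Assembly.LeafSystem C (T i)) ∧ Θ.res.X P = Xc.withTowerRuns10 T)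
    (h09 : ∀ P : B12.RunParams, B12Sec2to5.Lemma4Printed (Θ.res.X P).F12 (Θ.res.X P).c12)
    (h09T : ∀ P : B12.RunParams, (leavesP w P).smallCouplings → (leavesP w P).smallFieldInductive)
    (h10 : ∀ P : B12.RunParams, B9LeafX (Θ.res.Y P) →
      (B10.Thm1PrintedCompact (Θ.res.X P).runs10 ∧ B10.Thm2Printed (Θ.res.X P).runs10) →
        B11Leaf (Θ.res.Z P) → B12Sec2to5.Lemma4Printed (Θ.res.X P).F12 (Θ.res.X P).c12 →
          B13.Lemma1Printed (Θ.res.X P).S13 (Θ.res.X P).c13 ∧ B13.Lemma2Printed (Θ.res.X P).S13 (Θ.res.X P).c13 ∧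
            B13.Lemma3Printed (Θ.res.X P).S13 (Θ.res.X P).c13)
    (h11 : ∀ P : B12.RunParams, (leavesP w P).b7 → (leavesP w P).b8 → (leavesP w P).b9 → (leavesP w P).b10 → (leavesP w P).b11 →
      (leavesP w P).smallCouplings → (leavesP w P).smallFieldInductive → (leavesP w P).flowControl →
        ∀ k, k < P.K → SLaw₁₂ F N (Θ.liveRepin F N) P k → TLaw₁₂ F N (Θ.liveRepin F N) P k)
    (h12 : ∀ P : B12.RunParams, B15Leaf (W₀ P))
    (hcor3 : ∃ R : B14Cor3.ReprFamily (datumOfRecord₁₂ F N (Θ.liveRepin F N) hP).C,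
      B14Cor3.LeafH (datumOfRecord₁₂ F N (Θ.liveRepin F N) hP).C R w.γ ∧ B14Cor3.LeafU1 (datumOfRecord₁₂ F N (Θ.liveRepin F N) hP).C R w.γ ∧
        B14Cor3.LeafU2 (datumOfRecord₁₂ F N (Θ.liveRepin F N) hP).C R w.γ w.ep ∧ B14Cor3.LeafL1 (datumOfRecord₁₂ F N (Θ.liveRepin F N) hP).C R w.γ ∧
          B14Cor3.LeafL2 (datumOfRecord₁₂ F N (Θ.liveRepin F N) hP).C R w.γ w.em) :
    ∃ (θ' : Stage12Params F N) (h' : θ'.Provisos₁₂ F N) (w' : WorldP), (θ'.ZtUnity F N ∧ θ'.SlotsNondegenerate) ∧ θ'.Admissible F N ∧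
      IsRecordOfRecord₁₂C F N (datumOfRecord₁₂ F N θ' h') w' ∧ ∀ P : B12.RunParams, Nodes (leavesP w' P) :=
  nodesAtSomeRecord₁₂_of_pointed_pinW (Θ.liveRepin F N) hP hθ.liveRepin (guard_liveRepin_of_ztUnity Θ hzt hP.base) W₀ w hC hγ hL hup h05 h06 h07 h08 h09 h09T
    h10 h11 h12 (rRow_liveRepin Θ hP hθ hκ hE₀ hB₀) hcor3

end AnyW

/-! ## §4 The pointed conclusion and the `NodesAtSomeRecord12` body at a live re-pin, N12 at `λᵀ`, the (1.89) slot a per-run disjunction «raw display ∨ (window ∧ ℍ-leaves)» -/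

section Body
variable (Θ : Stage12Params F N) (hP : (Θ.liveRepin F N).Provisos₁₂ F N) (lam : ResidW F N) (σ : ∀ P : B12.RunParams, Sit189 F N P.K)
  (s : ∀ P : B12.RunParams, SeqOfRecord F Θ.ν Θ.τ9.M (gOfRecord₁₀ F N (Θ.liveRepin F N).toStage9Params P) P.K (lam.kSel P + 1)) (N₀ p₁ : ℕ)
  {D : (P : B12.RunParams) →
    Setting189 (F.P P.K) (SU N) (MSField (F.P P.K) (SU N) × ((j : ℕ) → VecField (F.P P.K) j (EuclideanSpace ℝ (Fin (N ^ 2 - 1))))) (Pt (F.P P.K).d)}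
  (hD : D = fun P => ((lam.pinRPrime (Θ.liveRepin F N).toStage9Params).pinD189T (Θ.liveRepin F N).toStage9Params σ s N₀ p₁).D189 P)
  (hθ : Θ.Admissible F N) (hκ : 0 ≤ Θ.s2.lf.κ) (hE₀ : 0 ≤ Θ.s2.lf.E₀) (hB₀ : 0 ≤ Θ.s2.lf.B₀)
  (w : WorldP) (hC : w.C = (datumOfRecord₁₂ F N (Θ.liveRepin F N) hP).C) (hγ : 0 < w.γ ∧ w.γ ≤ Θ.γ) (hL : w.L = (Θ.L : ℝ))
  (hup : ∀ P, w.up P = upOfRecord₅C F N (((Θ.liveRepin F N).pinW F N (WOfRecord₁₂ F N (Θ.liveRepin F N)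
    ((lam.pinRPrime (Θ.liveRepin F N).toStage9Params).pinD189T (Θ.liveRepin F N).toStage9Params σ s N₀ p₁))).toStage5₁₂ F N) P)
  (h05 : ∀ P : B12.RunParams,
    B8LeafR (Θ.res.X P).d8 (Θ.res.X P).L8 (Θ.res.X P).C₂ (Θ.res.X P).B₁' (Θ.res.X P).B₀' (Θ.res.X P).B₁ (Θ.res.X P).B₂ (Θ.res.X P).c₁
      (Θ.res.X P).inp8 (Θ.res.X P).B₀β (Θ.res.X P).loc8 (Θ.res.X P).fam8R (Θ.res.X P).lan8 (Θ.res.X P).cub8 (Θ.res.X P).toAxial8)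
  (h06 : ∀ P : B12.RunParams, B9LeafX (Θ.res.Y P))
  (h07 : ∀ P : B12.RunParams, B11Leaf (Θ.res.Z P))
  (h08 : ∀ P : B12.RunParams, ∃ (Xc : PrintedCarriersR) (I : Type) (C : B10Assembly.Consts) (T : I → B10.TowerRun),
    Nonempty (∀ i, B10Assembly.LeafSystem C (T i)) ∧ Θ.res.X P = Xc.withTowerRuns10 T)
  (h09 : ∀ P : B12.RunParams, B12Sec2to5.Lemma4Printed (Θ.res.X P).F12 (Θ.res.X P).c12)
  (h09T : ∀ P : B12.RunParams, (leavesP w P).smallCouplings → (leavesP w P).smallFieldInductive)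
  (h10 : ∀ P : B12.RunParams, B9LeafX (Θ.res.Y P) →
    (B10.Thm1PrintedCompact (Θ.res.X P).runs10 ∧ B10.Thm2Printed (Θ.res.X P).runs10) →
      B11Leaf (Θ.res.Z P) → B12Sec2to5.Lemma4Printed (Θ.res.X P).F12 (Θ.res.X P).c12 →
        B13.Lemma1Printed (Θ.res.X P).S13 (Θ.res.X P).c13 ∧ B13.Lemma2Printed (Θ.res.X P).S13 (Θ.res.X P).c13 ∧
          B13.Lemma3Printed (Θ.res.X P).S13 (Θ.res.X P).c13)
  (h11 : ∀ P : B12.RunParams, (leavesP w P).b7 → (leavesP w P).b8 → (leavesP w P).b9 → (leavesP w P).b10 → (leavesP w P).b11 →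
    (leavesP w P).smallCouplings → (leavesP w P).smallFieldInductive → (leavesP w P).flowControl →
      ∀ k, k < P.K → SLaw₁₂ F N (Θ.liveRepin F N) P k → TLaw₁₂ F N (Θ.liveRepin F N) P k)
  -- N12's displays at `λᵀ`, per run: `hdeg`, `hmassSel`, Prop. 1, (1.80), and «(1.89) raw ∨ (window ∧ the four ℍ-leaves)»
  (hN12 : ∀ P : B12.RunParams,
    (P.K ≤ lam.kSel P →
      (repDataOfSel (repTOfRecord9 F N Θ.ν Θ.τ9 (EOfRecord₁₀ F N (Θ.liveRepin F N).toStage9Params) (wOfRecord₉ F N (Θ.liveRepin F N).toStage9Params)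
          (Θ.liveRepin F N).ppSel P (gOfRecord₁₀ F N (Θ.liveRepin F N).toStage9Params P) (lam.kSel P))
        ((Θ.liveRepin F N).ppSel P (gOfRecord₁₀ F N (Θ.liveRepin F N).toStage9Params P) (lam.kSel P + 1))
        (fibOfSeq F Θ.ν Θ.τ9 P (gOfRecord₁₀ F N (Θ.liveRepin F N).toStage9Params P) (lam.kSel P + 1))).ProvisosSupp) ∧
    (∀ a, 0 < ∫ V, rterm (repTOfRecord9 F N Θ.ν Θ.τ9 (EOfRecord₁₀ F N (Θ.liveRepin F N).toStage9Params) (wOfRecord₉ F N (Θ.liveRepin F N).toStage9Params)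
      (Θ.liveRepin F N).ppSel P (gOfRecord₁₀ F N (Θ.liveRepin F N).toStage9Params P) (lam.kSel P))
      ((Θ.liveRepin F N).ppSel P (gOfRecord₁₀ F N (Θ.liveRepin F N).toStage9Params P) (lam.kSel P + 1) a) V ∂(fieldMeasure (F.P P.K) (lam.kSel P + 1) (SU N))) ∧
    Prop1Printed (lam.LF P) ∧
    (∀ U, new189 (D P) U → ∀ i, (D P).h ≤ i → i ≤ (D P).k → ∀ q ∈ plaqsOf (dom (D P) i),
      Ineq180 ((D P).dev0 U q) ((D P).ε (D P).k) (D P).η (D P).B₃ (D P).B₅ (D P).M (D P).δ ((D P).dist q) (D P).O1) ∧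
    (Claim189 (new189 (D P)) (chiPP (D P)) ∨
      (Step.InInterval Θ.γ (lam.kSel P + 1) (gOfRecord₁₀ F N (Θ.liveRepin F N).toStage9Params P) ∧
        (∀ U, new189 (D P) U → ∀ p ∈ plaqsOf (half (D P)),
          Ineq191 (dist1 (plaqHol ((D P).Upp U) p)) ((D P).devV'' U p) (D P).α (((D P).L ^ (D P).h)⁻¹) ((D P).ε (D P).h)
            (E124 (D P).ε (D P).L (D P).η (D P).k (D P).h)) ∧
        (∀ U, new189 (D P) U → ∀ p ∈ plaqsOf (half (D P)),
          Ineq195 ((D P).devV'' U p) (dist1 (plaqHol ((D P).Uhalf U ((D P).boxOf p)) p)) (D P).α (((D P).L ^ (D P).h)⁻¹) ((D P).ε (D P).h)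
            (E124 (D P).ε (D P).L (D P).η (D P).k (D P).h)) ∧
        (∀ U, new189 (D P) U → ∀ j, (D P).h ≤ j → j ≤ (D P).k → ∀ p ∈ plaqsOf (dom (D P) j),
          Ineq191 (dist1 (plaqHol ((D P).Upp U) p)) ((D P).dev97 U p) (D P).α (((D P).L ^ j)⁻¹) ((D P).ε j) (E124 (D P).ε (D P).L (D P).η (D P).k j)) ∧
        (∀ U, new189 (D P) U → ∀ j, (D P).h ≤ j → j ≤ (D P).k → ∀ p ∈ plaqsOf (dom (D P) j),
          Ineq191 ((D P).dev97 U p) ((D P).dev0 U p) (D P).α (((D P).L ^ j)⁻¹) ((D P).ε j) (E124 (D P).ε (D P).L (D P).η (D P).k j)))))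
  -- the run-independent (1.89) residue: levels, numerics, print's two conditions, geometry (closer's situation data), flow numerics, β-box bound
  (hN2 : 2 ≤ N₀) (hNN : N₀ ≤ Θ.τ9.Nmem) (hNk : ∀ P : B12.RunParams, N₀ ≤ lam.kSel P + 1)
  (hnum : ∀ P : B12.RunParams, 0 ≤ (σ P).β ∧ (σ P).β ≤ 1 / 4 ∧ 2 ≤ (σ P).L₀ ∧ (σ P).L₀ ^ 2 ≤ ((F.P P.K).L : ℝ) ∧
    0 ≤ (σ P).O1 * (σ P).B₃ * (σ P).B₅ ∧ 0 ≤ (σ P).δ ∧ ∀ p, 0 ≤ (σ P).dist p)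
  (hN₀ : ∀ P : B12.RunParams, (2 + (121 / 120) ^ 2 * ((σ P).O1 * (σ P).B₃ * (σ P).B₅ * (Θ.τ9.M : ℝ) ^ 5)) * (((σ P).L₀ ^ 2) ^ (N₀ - 1))⁻¹ ≤ 1 / 4)
  (hMl : ∀ P : B12.RunParams, (121 / 120) ^ 2 * ((σ P).O1 * (σ P).B₃ * (σ P).B₅ * (Θ.τ9.M : ℝ) ^ 5) * Real.exp (-(4 * (σ P).δ * (Θ.τ9.M : ℝ))) ≤ 1 / 12)
  (hZk : ∀ P : B12.RunParams, ∀ m, lam.kSel P + 1 - N₀ < m → m < lam.kSel P + 1 →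
    (σ P).Zpp (lam.kSel P + 1) ∩ omegaOfChain (s P) m ⊆ omegaOfChain (s P) (m + 1))
  (hgeom : ∀ P : B12.RunParams, ∀ m, (D P).k₀ < m → m < (D P).k → ∀ p ∈ plaqsOf ((D P).Ω m \ (D P).Ω (m + 1)),
    4 * ((m : ℝ) - (D P).k₀) * (D P).M ≤ (D P).dist p)
  (hbox : ∀ P : B12.RunParams, ∀ p ∈ plaqsOf (half (D P)), (D P).boxOf p ∈ (D P).halfcubes ∧ p ∈ (D P).plaqT ((D P).boxOf p))
  (hA₀ : 0 ≤ Θ.ν.A₀) {β' β₀ : ℝ} {L : ℕ} (S : SmallnessFor Θ.γ β' β₀ L Θ.ν.p₀) (hβ₀ : β₀ ≤ 1 / 2) (hε10 : Θ.γ * p0Profile Θ.ν.A₀ Θ.ν.p₀ Θ.γ ≤ 1 / 10)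
  (hub : BetaUpperH β' Θ.γ (betaOfRecord₁₀ F N (Θ.liveRepin F N).toStage9Params))
  (hcor3 : ∃ R : B14Cor3.ReprFamily (datumOfRecord₁₂ F N (Θ.liveRepin F N) hP).C,
    B14Cor3.LeafH (datumOfRecord₁₂ F N (Θ.liveRepin F N) hP).C R w.γ ∧ B14Cor3.LeafU1 (datumOfRecord₁₂ F N (Θ.liveRepin F N) hP).C R w.γ ∧
      B14Cor3.LeafU2 (datumOfRecord₁₂ F N (Θ.liveRepin F N) hP).C R w.γ w.ep ∧ B14Cor3.LeafL1 (datumOfRecord₁₂ F N (Θ.liveRepin F N) hP).C R w.γ ∧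
        B14Cor3.LeafL2 (datumOfRecord₁₂ F N (Θ.liveRepin F N) hP).C R w.γ w.em)

include hD hN12 hN2 hNN hNk hnum hN₀ hMl hZk hgeom hbox hA₀ S hβ₀ hε10 hub in
/-- The (1.89) slot at `λᵀ`, run by run, from the disjunction: raw, or — on a run in the window — n12-e's `h189_pinD189T_of_h180` from (1.80) + the ℍ-leaves + the residue.
[cite: Balaban1989LargeFieldI, (1.89) p.198, pp.199–200, (1.80) p.195; Balaban1988Convergent, (2.1) p.254, (2.8) p.256] -/
theorem h189_pinAllT_of_disj (P : B12.RunParams) : Claim189 (new189 (D P)) (chiPP (D P)) := by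
  obtain ⟨-, -, -, h180, h189 | ⟨hI, L91h, L95, L91, L97⟩⟩ := hN12 P
  · exact h189
  · obtain ⟨hβ0, hβ, hL₀, hL₀L, hB, hδ, hdist⟩ := hnum P
    subst hD
    exact h189_pinD189T_of_h180 (lam := lam.pinRPrime (Θ.liveRepin F N).toStage9Params) (σT := σ) (sT := s) (N₀ := N₀) (p₁ := p₁) P hN2 hNN (hNk P)
      hβ0 hβ hL₀ hL₀L hB hδ hdist (hN₀ P) (hMl P) hA₀ S hβ₀ hε10 hI hub (hZk P) (hgeom P) (hbox P) L91h L95 L91 L97 h180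

include hD hθ hκ hE₀ hB₀ hC hγ hL hup h05 h06 h07 h08 h09 h09T h10 h11 hN12 hN2 hNN hNk hnum hN₀ hMl hZk hgeom hbox hA₀ S hβ₀ hε10 hub hcor3 in
/-- **★ THE THIRTEEN NODES AT THE CLOSER's OWN WORLD BOUND TO THE LIVE RE-PIN W-PINNED AT `WOfRecord₁₂ θ₉′ λᵀ`** — module 3's `nodes₁₂_pointed_liveRepin_pinW_of_massSel_of_signs`
at `σᵀ` with the (1.89) slot SUPPLIED run by run by `h189_pinAllT_of_disj`.  DISPLAYED (section hypotheses): `Provisos₁₂` at the re-pin (K0′), `Θ.Admissible`, the signs,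
rows N05–N11 + Cor.-3 as module 27, N12's `hdeg ∧ hmassSel ∧ Prop 1 ∧ (1.80) ∧ ((1.89) ∨ window ∧ ℍ-leaves)` per run, and the run-independent residue.  The guard and N13's
𝐑-row are THEOREMS (module 3).  COMPOSITE; NOT a discharge; count-neutral. [cite: Balaban1989LargeFieldII, Thm 1 p.355, (0.1) pp.355–356, p.391; Balaban1989LargeFieldI, (0.2)–(0.6) p.176, p.177, Prop. 1 (1.78) p.194, (1.80) p.195, (1.89) p.198, pp.199–200; Balaban1988Convergent, p.244, (2.1) p.254, Thm 2 p.263 (node bookkeeping at the re-pin's objects)] -/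
theorem nodes₁₂_pointed_liveRepin_pinW_pinAllT :
    IsRecordOfRecord₁₂C F N (datumOfRecord₁₂ F N (Θ.liveRepin F N) hP) w ∧ ∀ P : B12.RunParams, Nodes (leavesP w P) := by
  have h189 := h189_pinAllT_of_disj Θ lam σ s N₀ p₁ hD hN12 hN2 hNN hNk hnum hN₀ hMl hZk hgeom hbox hA₀ S hβ₀ hε10 hub
  subst hD
  exact nodes₁₂_pointed_liveRepin_pinW_of_massSel_of_signs Θ hP lam (fun P => ((σ P).pinTerm (s P)).pinNumerics Θ.τ9 N₀) p₁ hθ hκ hE₀ hB₀ w hC hγ hL hup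
    h05 h06 h07 h08 h09 h09T h10 h11
    (fun P => by
      obtain ⟨hdeg, hmassSel, hP1, h180, -⟩ := hN12 P
      exact ⟨hdeg, hmassSel, hP1, fun U hU i hi hik q hq => h180 U hU i hi hik q hq, h189 P⟩)
    hcor3

include hD hθ hκ hE₀ hB₀ hC hγ hL hup h05 h06 h07 h08 h09 h09T h10 h11 hN12 hN2 hNN hNk hnum hN₀ hMl hZk hgeom hbox hA₀ S hβ₀ hε10 hub hcor3 in
/-- **★ THE BODY OF `NodesAtSomeRecord12` AT A LIVE RE-PIN WITH N12 AT `λᵀ`** — module 3's `nodesAtSomeRecord₁₂_of_pointed_liveRepin_pinW_of_massSel_of_signs` at `σᵀ` with the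
(1.89) slot supplied run by run; print's partition of unity `Θ.ZtUnity` is the one extra display (the guard conjunct and N13's 𝐑-row are theorems).  The stub's ∃-text is witnessed
by the W-pinned re-pin itself.  COMPOSITE; NOT a discharge; count-neutral. [cite: Balaban1989LargeFieldII, Thm 1 p.355 + p.391; Balaban1989LargeFieldI, (0.2)–(0.6) p.176, p.177, Prop. 1 (1.78) p.194, (1.80) p.195, (1.89) p.198, pp.199–200; Balaban1988Convergent, p.244, Thm 2 p.263, (3.16)–(3.22) pp.268–269 (bookkeeping: the stub's body on a live re-pin)] -/
theorem nodesAtSomeRecord₁₂_of_pointed_liveRepin_pinW_pinAllT (hzt : Θ.ZtUnity F N) :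
    ∃ (θ' : Stage12Params F N) (h' : θ'.Provisos₁₂ F N) (w' : WorldP), (θ'.ZtUnity F N ∧ θ'.SlotsNondegenerate) ∧ θ'.Admissible F N ∧
      IsRecordOfRecord₁₂C F N (datumOfRecord₁₂ F N θ' h') w' ∧ ∀ P : B12.RunParams, Nodes (leavesP w' P) := by
  have h189 := h189_pinAllT_of_disj Θ lam σ s N₀ p₁ hD hN12 hN2 hNN hNk hnum hN₀ hMl hZk hgeom hbox hA₀ S hβ₀ hε10 hub
  subst hD
  exact nodesAtSomeRecord₁₂_of_pointed_liveRepin_pinW_of_massSel_of_signs Θ hP lam (fun P => ((σ P).pinTerm (s P)).pinNumerics Θ.τ9 N₀) p₁ hθ hzt hκ hE₀ hB₀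
    w hC hγ hL hup h05 h06 h07 h08 h09 h09T h10 h11
    (fun P => by
      obtain ⟨hdeg, hmassSel, hP1, h180, -⟩ := hN12 P
      exact ⟨hdeg, hmassSel, hP1, fun U hU i hi hik q hq => h180 U hU i hi hik q hq, h189 P⟩)
    hcor3

end Body

end Summit.QuantumFields.YangMills.BalabanUVNodes.N12AtRecord12TermPinned

end
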